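import Summits.AtomisticToContinuum.HydrodynamicLimit.Theorems.MourreKoopmanChargesStressStrongMixingStaticClusteringMixing
import Summits.AtomisticToContinuum.HydrodynamicLimit.Theorems.MourreKoopmanChargesStressStrongMixingStaticClusteringMoments
import Summits.AtomisticToContinuum.HydrodynamicLimit.Theorems.MourreKoopmanChargesStressStrongMixingStaticClusteringLocality
import Summits.AtomisticToContinuum.HydrodynamicLimit.Theorems.MourreKoopmanChargesStressStrongMixingDiluteGibbsDensityOne
import Literature.MathematicalPhysics.KineticTheory.HardSphereGibbsGNZSandwich
import Mathlib.Analysis.SpecialFunctions.JapaneseBracket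
import HarnessLib

/-!
# `StressStrongMixing` · line `birth`: stub F3static `stub_staticClustering`
# (static spatial clustering of the six generators under the density-one dilute hard-sphere Gibbs state)

Closes the registered stub `stub_staticClustering` of the skeleton `Cruxes/StressStrongMixing/Lines/birth.lean` (crux item
stmt-AtomisticToContinuum-9584, route `MourreKoopmanCharges` of `AtomisticToContinuum/HydrodynamicLimit`): there is
`σ₃ > 0` (here `σ₃ = 1/4`) such that for `0 < σ < σ₃`, `θ, z > 0` and every translation-invariant hard-sphere Gibbs state
`μ` at `(σ, z, θ⁻¹)` of density one, for any two of the six generators `a, b` (five cell charges, cell shear stress) the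
static truncated two-point function is spatially integrable: `x ↦ Cov_μ(a, b ∘ τ_x) ∈ L¹(ℝ³)`.

Proof (Ruelle 1969 §4.4 / Spohn 1991 Part I Condition 2.1, at the level of DLR measures):
1. density one forces `z ≤ 2` (`activity_le_two_of_density_one`: dilate to unit diameter, density `σ³ ≤ 1/16`, GNZ
   sandwich `activity_le_two_mul_density`), so `q := 16 z σ³ ≤ 1/2` and the pinning regime `16 z σ³ < 1` holds;
2. for `‖x‖ ≥ 8 + 2σ` put `d = ⌊(‖x‖ - 8)/σ⌋ - 2`, `K = q^{-d/2}`: the `φ`-mixing bound `abs_cov_le_of_isHardSphereGibbs`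
   (part 1b) applied to the clamp `clamp_K a` (local in `B(0,4)`, bounded by `K`) and `b ∘ τ_x` (a cylinder function of
   the complement of `B(0, ‖x‖ - 4)`, part 3) gives `|Cov(clamp_K a, b ∘ τ_x)| ≤ 2 K Φ₀ qᵈ ‖b‖₁`, and the finite fourth
   moments (part 2) give `|Cov(a - clamp_K a, b ∘ τ_x)| ≤ ‖a‖₄² ‖b‖₂ / K`; total `≤ A q^{d/2} ≤ A' e^{-c‖x‖}`,
   `c = log(1/q)/(2σ) > 0` (`abs_cov_generators_spatialShift_le`);
3. `e^{-c‖x‖}` is integrable on `ℝ³`, and the landed reduction `integrable_cov_comp_spatialShift_of_decay` concludes.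

References: D. Ruelle, *Statistical Mechanics* (1969), §4.2 Thm 4.2.3, §4.4; H. Spohn, *Large Scale Dynamics of
Interacting Particles* (1991), Part I §2.2 Condition 2.1, §7.1; M. Michelen, W. Perkins, arXiv:2109.01094, Thm 3 / 25.
-/

noncomputable section

open MeasureTheory ProbabilityTheory Filter Topology
open scoped ENNReal

namespace Summit.AtomisticToContinuum.HydrodynamicLimit.Theorems.MourreKoopmanChargesStressStrongMixing

open Literature.MathematicalPhysics.KineticTheory Literature.Analysis.FluidPDE
open Literature.Analysis.FunctionSpaces (PointConfig maxwellianBeta)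
open Literature.MathematicalPhysics.StatisticalMechanics.HardSphere (window)

/-! ### Density one forces a bounded activity -/

/-- **Density one forces `z ≤ 2` at small diameter**: a translation-invariant hard-sphere Gibbs state of diameter
`σ` with `σ³ ≤ 1/16`, activity `z ≥ 0`, `β > 0`, zero drift and density one has `z ≤ 2` — dilate by `σ⁻¹` to unit
diameter (activity `z σ³`, density `σ³`) and apply the GNZ sandwich `activity_le_two_mul_density` (`8 σ³ ≤ 1/2`).
[cite: Dereudre2019, Thm 2 and Prop. 10] -/
theorem activity_le_two_of_density_one {σ z β : ℝ} (hσ : 0 < σ) (hσ1 : σ ^ 3 ≤ 1 / 16) (hz : 0 ≤ z) (hβ : 0 < β)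
    {μ : Measure MarkedConfig} (hG : IsHardSphereGibbs σ z β (0 : V3) μ) (hti : IsTranslationInvariant μ)
    (hρ : PointProcess.density μ = 1) : z ≤ 2 := by
  set D : V3 × V3 ≃ₜ V3 × V3 := (Homeomorph.smulOfNeZero σ⁻¹ (inv_ne_zero hσ.ne')).prodCongr (Homeomorph.refl V3)
    with hDdef
  have hD : ∀ p, D p = (σ⁻¹ • p.1, p.2) := fun _ => rfl
  have hc : 0 < σ⁻¹ := inv_pos.2 hσ
  have hG' := hG.map_dilate hc hD
  rw [Fintype.card_fin, inv_mul_cancel₀ hσ.ne', inv_pow, div_inv_eq_mul] at hG'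
  have hti' := isTranslationInvariant_map_dilate hc.ne' hD hti
  have hρ' : PointProcess.density (μ.map (PointConfig.mapHomeomorph D)) = ENNReal.ofReal (σ ^ 3) := by
    rw [density_map_dilate hti (by rw [hρ]; exact ENNReal.one_ne_top) hc hD, hρ, mul_one, Fintype.card_fin, inv_pow,
      inv_inv]
  have h8 : ((2 ^ Fintype.card (Fin 3) : ℕ) : ℝ) * σ ^ 3 ≤ 1 / 2 := by
    rw [Fintype.card_fin]; norm_num; linarith
  have key := HardSphereDLR.activity_le_two_mul_density hG' hti' (mul_nonneg hz (pow_nonneg hσ.le 3)) hβ (n := 2)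
    (by norm_num) hρ' (pow_nonneg hσ.le 3) h8
  have hσ3 : 0 < σ ^ 3 := pow_pos hσ 3
  nlinarith

/-! ### An integrable exponential majorant on `ℝ³` -/

/-- `x ↦ e^{-c‖x‖}` is integrable on `ℝ³` for `c > 0` (dominated by `24 e^c c⁻⁴ (1 + ‖x‖)⁻⁴`). [folklore] -/
theorem integrable_exp_neg_mul_norm {c : ℝ} (hc : 0 < c) : Integrable (fun x : V3 => Real.exp (-(c * ‖x‖))) volume := by
  have hint := integrable_one_add_norm (E := V3) (μ := (volume : Measure V3)) (r := 4)
    (by rw [finrank_euclideanSpace, Fintype.card_fin]; norm_num)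
  refine (hint.const_mul (24 * Real.exp c / c ^ 4)).mono' (by fun_prop) (ae_of_all _ fun x => ?_)
  rw [Real.norm_eq_abs, abs_of_nonneg (Real.exp_nonneg _)]
  have hP : 0 < (1 + ‖x‖) ^ 4 := by positivity
  have h1 := Real.pow_div_factorial_le_exp (c * (1 + ‖x‖)) (by positivity) 4
  rw [show (Nat.factorial 4 : ℝ) = 24 by norm_num [Nat.factorial], mul_pow, mul_add, mul_one, Real.exp_add,
    div_le_iff₀ (by norm_num : (0 : ℝ) < 24)] at h1
  rw [show (-(4 : ℝ)) = -((4 : ℕ) : ℝ) by norm_num, Real.rpow_neg (by positivity), Real.rpow_natCast,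
    ← div_eq_mul_inv, div_div, Real.exp_neg, inv_eq_one_div, div_le_div_iff₀ (Real.exp_pos _) (by positivity)]
  nlinarith [Real.exp_pos c, Real.exp_pos (c * ‖x‖)]

/-! ### The per-shift covariance bound: `φ`-mixing of the clamp plus the clamping error -/

/-- **The static truncated two-point function of two generators, pointwise bound**: for a hard-sphere Gibbs state
`μ` at `(σ, z, θ⁻¹)` with `16 z σ³ < 1`, translation invariant, generators `a, b`, a shift `x` with
`8 + (d + 2)σ ≤ ‖x‖` and any `K > 0`,
`|Cov_μ(a, b ∘ τ_x)| ≤ 2 K Φ (16 z σ³)^d ‖b‖₁ + (E a⁴)^{1/2} (E b²)^{1/2} / K`, `Φ = 2 ν(B_4 × ℝ³) e^{ν(B_4 × ℝ³)}`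
(clamp `a` at height `K`: `φ`-mixing for the clamp, Cauchy–Schwarz and fourth moments for the error).
[cite: MichelenPerkins2021, Thm 3 and Thm 25] -/
theorem abs_cov_generators_spatialShift_le {σ z θ : ℝ} (hσ : 0 < σ) (hz : 0 < z) (hzσ : 16 * (z * σ ^ 3) < 1)
    (hθ : 0 < θ) {μ : Measure MarkedConfig} (hG : IsHardSphereGibbs σ z θ⁻¹ (0 : V3) μ)
    (hti : IsTranslationInvariant μ)
    {a : MarkedConfig → ℝ} (ha : a ∈ Set.range cellCharge ∪ {cellObs fun v : V3 => v 0 * v 1})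
    {b : MarkedConfig → ℝ} (hb : b ∈ Set.range cellCharge ∪ {cellObs fun v : V3 => v 0 * v 1})
    {x : V3} {d : ℕ} (hx : 8 + (d + 2) * σ ≤ ‖x‖) {K : ℝ} (hK : 0 < K) :
    |cov[a, b ∘ spatialShift x; μ]| ≤
      2 * K * (2 * ((Real.toNNReal z) • ((volume : Measure V3).prod ((volume : Measure V3).withDensity
            fun v => ENNReal.ofReal (maxwellianBeta θ⁻¹ (v - 0))))).real (window (Metric.ball (0 : V3) 4)) *
          Real.exp (((Real.toNNReal z) • ((volume : Measure V3).prod ((volume : Measure V3).withDensity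
            fun v => ENNReal.ofReal (maxwellianBeta θ⁻¹ (v - 0))))).real (window (Metric.ball (0 : V3) 4))) *
          (2 * (8 * (z * σ ^ 3))) ^ d) * ∫ ω, |b ω| ∂μ +
        Real.sqrt (∫ ω, a ω ^ 4 ∂μ) * Real.sqrt (∫ ω, b ω ^ 2 ∂μ) / K := by
  haveI := hG.1
  have hshift : MeasurePreserving (spatialShift x) μ μ := ⟨PointConfig.measurable_translate _, hti x⟩
  have ham : Measurable a := measurable_of_mem_generators a ha
  have hbm : Measurable b := measurable_of_mem_generators b hb
  have ha2 : MemLp a 2 μ := memLp_generators_of_isHardSphereGibbs σ θ z hσ hθ hz μ hG a ha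
  have hb2 : MemLp b 2 μ := memLp_generators_of_isHardSphereGibbs σ θ z hσ hθ hz μ hG b hb
  have ha4 : Integrable (fun ω => a ω ^ 4) μ := integrable_pow_four_of_mem_generators hθ hz hG ha
  have hgm : Measurable (b ∘ spatialShift x) := hbm.comp (PointConfig.measurable_translate _)
  have hg2 : MemLp (b ∘ spatialShift x) 2 μ := hb2.comp_measurePreserving hshift
  -- the clamp of `a`
  set f : MarkedConfig → ℝ := fun ω => max (-K) (min (a ω) K) with hfdef
  have hfm : Measurable f := measurable_clamp ham K
  have hfK : ∀ ω, |f ω| ≤ K := fun ω => abs_le.2 ⟨le_max_left _ _, max_le (by linarith) (min_le_right _ _)⟩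
  have hf2 : MemLp f 2 μ := memLp_of_bounded (a := -K) (b := K)
    (ae_of_all _ fun ω => ⟨(abs_le.1 (hfK ω)).1, (abs_le.1 (hfK ω)).2⟩) hfm.aestronglyMeasurable 2
  have hfr : ∀ ω, f (PointConfig.restrict (window (Metric.ball (0 : V3) 4)) ω) = f ω := fun ω =>
    clamp_restrict_window_ball_of_mem_generators ha K ω
  -- geometry of the shift
  have hR : (4 : ℝ) + (d + 2) * σ ≤ ‖x‖ - 4 := by linarith
  have hR' : ‖x‖ - 4 + 4 ≤ ‖x‖ := by linarith
  have hgcyl : ∀ (n : ℕ) (ξ : Fin n → V3 × V3) (Y : MarkedConfig),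
      (b ∘ spatialShift x) (superposeIn (Metric.ball (0 : V3) (‖x‖ - 4)) ξ Y) = (b ∘ spatialShift x) Y :=
    fun n ξ Y => comp_spatialShift_superposeIn_ball_of_mem_generators hb hR' n ξ Y
  -- the two invariant integrals
  have hI1 : ∫ ω, |(b ∘ spatialShift x) ω| ∂μ = ∫ ω, |b ω| ∂μ := by
    have h := integral_map (μ := μ) (PointConfig.measurable_translate ((x, (0 : V3)) : V3 × V3)).aemeasurable
      (f := fun ω => |b ω|) hbm.norm.aestronglyMeasurable
    rw [hti x] at h
    simpa only [Function.comp_apply, spatialShift_apply] using h.symm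
  have hI2 : ∫ ω, ((b ∘ spatialShift x) ω) ^ 2 ∂μ = ∫ ω, b ω ^ 2 ∂μ := by
    have h := integral_map (μ := μ) (PointConfig.measurable_translate ((x, (0 : V3)) : V3 × V3)).aemeasurable
      (f := fun ω => b ω ^ 2) (hbm.pow_const 2).aestronglyMeasurable
    rw [hti x] at h
    simpa only [Function.comp_apply, spatialShift_apply] using h.symm
  -- the two pieces
  have hmix := abs_cov_le_of_isHardSphereGibbs hσ hz.le hzσ (inv_pos.2 hθ) hG hR hfm hK.le hfK hfr hgm hg2 hgcyl
  have hclamp := abs_cov_sub_clamp_le ham ha4 hg2 hK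
  rw [hI1] at hmix
  rw [hI2] at hclamp
  have hsplit : cov[a, b ∘ spatialShift x; μ] =
      cov[f, b ∘ spatialShift x; μ] + cov[fun ω => a ω - max (-K) (min (a ω) K), b ∘ spatialShift x; μ] := by
    rw [covariance_fun_sub_left ha2 hf2 hg2]; ring
  rw [hsplit]
  exact (abs_add_le _ _).trans (add_le_add hmix hclamp)

/-! ### Bookkeeping of the exponent and the registered stub -/

/-- **Choice of the depth**: for `σ > 0` and `8 + 2σ ≤ ‖x‖`, the natural number `d = ⌊(‖x‖ - 8)/σ⌋ - 2` satisfies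
`8 + (d + 2)σ ≤ ‖x‖` and `(‖x‖ - 8)/σ - 3 ≤ d`. [folklore] -/
theorem depth_spec {σ : ℝ} (hσ : 0 < σ) {x : V3} (hx : 8 + 2 * σ ≤ ‖x‖) :
    8 + ((⌊(‖x‖ - 8) / σ⌋₊ - 2 : ℕ) + 2) * σ ≤ ‖x‖ ∧ (‖x‖ - 8) / σ - 3 ≤ ((⌊(‖x‖ - 8) / σ⌋₊ - 2 : ℕ) : ℝ) := by
  have hy0 : 0 ≤ (‖x‖ - 8) / σ := div_nonneg (by linarith) hσ.le
  have hy2 : (2 : ℝ) ≤ (‖x‖ - 8) / σ := by rw [le_div_iff₀ hσ]; linarith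
  have hfl2 : 2 ≤ ⌊(‖x‖ - 8) / σ⌋₊ := Nat.le_floor (by exact_mod_cast hy2)
  have hcast : (((⌊(‖x‖ - 8) / σ⌋₊ - 2 : ℕ) : ℝ)) = (⌊(‖x‖ - 8) / σ⌋₊ : ℝ) - 2 := by
    rw [Nat.cast_sub hfl2, Nat.cast_ofNat]
  rw [hcast]
  constructor
  · have h1 : (⌊(‖x‖ - 8) / σ⌋₊ : ℝ) ≤ (‖x‖ - 8) / σ := Nat.floor_le hy0
    have h2 : (⌊(‖x‖ - 8) / σ⌋₊ : ℝ) * σ ≤ ‖x‖ - 8 := by rwa [← le_div_iff₀ hσ]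
    linarith
  · have h1 : (‖x‖ - 8) / σ < ⌊(‖x‖ - 8) / σ⌋₊ + 1 := Nat.lt_floor_add_one _
    linarith

/-- **Geometric decay**: for `0 < s ≤ 1`, a natural number `d` and a real `D ≤ d`, `s^d ≤ e^{(log s) D}`. [folklore] -/
theorem pow_le_exp_log_mul {s : ℝ} (hs : 0 < s) (hs1 : s ≤ 1) {d : ℕ} {D : ℝ} (hD : D ≤ d) :
    s ^ d ≤ Real.exp (Real.log s * D) := by
  rw [← Real.rpow_natCast, Real.rpow_def_of_pos hs]
  exact Real.exp_le_exp.2 (mul_le_mul_of_nonpos_left hD (Real.log_nonpos hs.le hs1))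

/-- **Registered stub `stub_staticClustering`** (F3static of the line `birth` of `StressStrongMixing`): static spatial
clustering of the six generators for the density-one dilute hard-sphere Gibbs state — for `0 < σ < 1/4`, `θ, z > 0`,
every translation-invariant density-one hard-sphere DLR state `μ` at `(σ, z, θ⁻¹)` and any two generators `a, b`,
`x ↦ Cov_μ(a, b ∘ τ_x)` is integrable on `ℝ³` (exponential `φ`-mixing from uniform boundary-condition pinning,
Maxwellian truncation by clamping, and the landed reduction `integrable_cov_comp_spatialShift_of_decay`).
[cite: MichelenPerkins2021, Thm 3 and Thm 25] -/
theorem stub_staticClustering :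
    ∃ σ₃ : ℝ, 0 < σ₃ ∧ ∀ σ : ℝ, 0 < σ → σ < σ₃ → ∀ θ z : ℝ, 0 < θ → 0 < z →
      ∀ μ : Measure MarkedConfig, IsHardSphereGibbs σ z θ⁻¹ (0 : V3) μ → IsTranslationInvariant μ →
        PointProcess.density μ = 1 →
        ∀ a ∈ Set.range cellCharge ∪ {cellObs fun v : V3 => v 0 * v 1},
        ∀ b ∈ Set.range cellCharge ∪ {cellObs fun v : V3 => v 0 * v 1},
          Integrable (fun x : V3 => cov[a, b ∘ spatialShift x; μ]) volume := by
  refine ⟨1 / 4, by norm_num, fun σ hσ hσ4 θ z hθ hz μ hG hti hρ a ha b hb => ?_⟩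
  haveI := hG.1
  -- smallness: `σ³ ≤ 1/64`, `z ≤ 2`, `q = 16 z σ³ ∈ (0, 1/2]`
  have hσ3 : σ ^ 3 ≤ 1 / 64 := by
    have h : σ ^ 3 ≤ (1 / 4) ^ 3 := pow_le_pow_left₀ hσ.le hσ4.le 3
    norm_num at h
    exact h
  have hz2 : z ≤ 2 := activity_le_two_of_density_one hσ (by linarith) hz.le (inv_pos.2 hθ) hG hti hρ
  set q : ℝ := 2 * (8 * (z * σ ^ 3)) with hqdef
  have hq0 : 0 < q := by positivity
  have hq1 : q ≤ 1 / 2 := by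
    have : z * σ ^ 3 ≤ 2 * (1 / 64) := mul_le_mul hz2 hσ3 (by positivity) zero_le_two
    rw [hqdef]; linarith
  have hzσ : 16 * (z * σ ^ 3) < 1 := by rw [hqdef] at hq1; linarith
  set s : ℝ := Real.sqrt q with hsdef
  have hs0 : 0 < s := Real.sqrt_pos.2 hq0
  have hs1 : s < 1 := by
    rw [hsdef, Real.sqrt_lt' one_pos]; linarith
  have hsq : s ^ 2 = q := Real.sq_sqrt hq0.le
  have hlog : Real.log s < 0 := Real.log_neg hs0 hs1
  -- the constants of the majorant
  set Φ : ℝ := 2 * ((Real.toNNReal z) • ((volume : Measure V3).prod ((volume : Measure V3).withDensity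
      fun v => ENNReal.ofReal (maxwellianBeta θ⁻¹ (v - 0))))).real (window (Metric.ball (0 : V3) 4)) *
    Real.exp (((Real.toNNReal z) • ((volume : Measure V3).prod ((volume : Measure V3).withDensity
      fun v => ENNReal.ofReal (maxwellianBeta θ⁻¹ (v - 0))))).real (window (Metric.ball (0 : V3) 4))) with hΦdef
  have hΦ0 : 0 ≤ Φ := by rw [hΦdef]; exact mul_nonneg (mul_nonneg zero_le_two measureReal_nonneg) (Real.exp_nonneg _)
  set A : ℝ := 2 * Φ * ∫ ω, |b ω| ∂μ + Real.sqrt (∫ ω, a ω ^ 4 ∂μ) * Real.sqrt (∫ ω, b ω ^ 2 ∂μ) with hAdef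
  have hA0 : 0 ≤ A := by
    rw [hAdef]
    exact add_nonneg (mul_nonneg (mul_nonneg zero_le_two hΦ0) (integral_nonneg fun ω => abs_nonneg _))
      (mul_nonneg (Real.sqrt_nonneg _) (Real.sqrt_nonneg _))
  -- the majorant `g(x) = A exp(log s ((‖x‖ - 8)/σ - 3)) = A e^{-(3 + 8/σ) log s} e^{-c‖x‖}`, `c = -log s / σ`
  set c : ℝ := -Real.log s / σ with hcdef
  have hc : 0 < c := div_pos (by linarith) hσ
  have hgeq : ∀ y : V3, A * Real.exp (Real.log s * ((‖y‖ - 8) / σ - 3)) =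
      A * Real.exp (-(Real.log s) * (8 / σ + 3)) * Real.exp (-(c * ‖y‖)) := fun y => by
    rw [mul_assoc, ← Real.exp_add]
    congr 2
    rw [hcdef]
    field_simp
    ring
  have hgint : Integrable (fun y : V3 => A * Real.exp (Real.log s * ((‖y‖ - 8) / σ - 3))) volume := by
    simp_rw [hgeq]
    exact (integrable_exp_neg_mul_norm hc).const_mul _
  -- the endgame
  have hshift : ∀ y : V3, MeasurePreserving (spatialShift y) μ μ := fun y =>
    ⟨PointConfig.measurable_translate _, hti y⟩
  refine integrable_cov_comp_spatialShift_of_decay hshift (measurable_of_mem_generators a ha)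
    (measurable_of_mem_generators b hb) (memLp_generators_of_isHardSphereGibbs σ θ z hσ hθ hz μ hG a ha)
    (memLp_generators_of_isHardSphereGibbs σ θ z hσ hθ hz μ hG b hb) hgint (R := 8 + 2 * σ) fun x hx => ?_
  -- the decay estimate at a shift `x` with `‖x‖ ≥ 8 + 2σ`
  obtain ⟨hd1, hd2⟩ := depth_spec hσ hx
  set d : ℕ := ⌊(‖x‖ - 8) / σ⌋₊ - 2 with hddef
  have hsd : 0 < s ^ d := pow_pos hs0 d
  have key := abs_cov_generators_spatialShift_le hσ hz hzσ hθ hG hti ha hb hd1 (inv_pos.2 hsd)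
  have hqd : q ^ d = s ^ d * s ^ d := by rw [← hsq, ← mul_pow, sq]
  calc |cov[a, b ∘ spatialShift x; μ]|
      ≤ 2 * (s ^ d)⁻¹ * (Φ * q ^ d) * ∫ ω, |b ω| ∂μ +
          Real.sqrt (∫ ω, a ω ^ 4 ∂μ) * Real.sqrt (∫ ω, b ω ^ 2 ∂μ) / (s ^ d)⁻¹ := by
        simpa only [hΦdef, hqdef, mul_assoc] using key
    _ = A * s ^ d := by
        rw [hqd, hAdef, div_inv_eq_mul]
        field_simp
    _ ≤ A * Real.exp (Real.log s * ((‖x‖ - 8) / σ - 3)) :=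
        mul_le_mul_of_nonneg_left (pow_le_exp_log_mul hs0 hs1.le hd2) hA0

end Summit.AtomisticToContinuum.HydrodynamicLimit.Theorems.MourreKoopmanChargesStressStrongMixing

end
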